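import Summits.QuantumAdvantage.QuantumAdvantage.Theorems.NearExactIsExact.Negative.LevelSixSixtyOnePrep
import Summits.QuantumAdvantage.QuantumAdvantage.Theorems.CubicForrelationNearExactIsExactSecondWeight
import Summits.QuantumAdvantage.QuantumAdvantage.Theorems.CubicForrelationNearExactIsExactFourteenSecondStructure

/-!
# Level 6 × level 6: no cubic pair on 14 bits has `61/64 < Φ` with both sides at level 6 (NearExactIsExact, disprover gen 24)

Negative/structural theorem for the crux `CubicForrelation.NearExactIsExact` (item r2), finite slice `n = 14`.
HONEST FRAMING: a statement about cubic Boolean functions on 14 bits — NOT summit progress; no violation of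
`NearExactIsExact`.  With `…Negative.TypeOSixtyOneFourteen` it yields `θ₁₄ ≤ 61/64` (assembled in `…Negative.ThetaFourteenSixtyOne`).

Setting: `f, g : 𝔽₂¹⁴ → 𝔽₂` cubic, `W_g = 64u'`, `W_f = 64v'` with odd values on both sides (level 6 proper), `s = (−1)^f`,
residual `e = u' − 2s`, budget `B = Σ_x e(x)² = 2¹⁷(1 − Φ)`; `61/64 < Φ` means `B < 6144`.  The slack version of `fl_levelSix_false`:
1. `P = {u' odd}` is the support of a non-zero quadratic with `#P ≤ B < 6144 = 1.5·2¹²`, so `#P = 2¹²` (Kasami–Tokura second weight,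
   `sw_quadratic_second_weight`) and `P = x₁ ⊕ V₀` is a 12-flat (`qf_flat_of_quadratic`); the slack `σ = B − 2¹² < 2¹¹` bounds the
   off-`P` defects `D = {x ∉ P : e(x) ≠ 0}` by `#D ≤ 511` (each costs `≥ 4`).
2. MOD-4 CHARACTER: for `c, c' ∈ V₀` choose transversal `d₁, d₂` whose twelve translates of the 2-flat `x₁ ⊕ ⟨c,c'⟩` avoid `D`
   (`lsp_dirs`); the general 4-flat sum (`fs_flat_sum_dvd`, `k = 4`) then gives `4 ∣ e(x₁) + e(x₁⊕c) + e(x₁⊕c') + e(x₁⊕c⊕c')`, so the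
   mod-4 sign `χ = 2 − (e mod 4)` is multiplicative on the coset: `χ·1_P` is a `±`character, its transform is `±2¹²` at exactly FOUR
   frequencies (`fl_char_coset`, Parseval, `lsp_four_freq`).
3. The residual is close to the character: `Σ_x |e − χ1_P| ≤ σ/2` (`lsp_cost_on/off`), so `|ê(y)| ≥ 2¹² − σ/2 > 3072` at the four
   frequencies; and `ê = 256(−1)^g − 2W_f = −128·e_f` with `e_f = v' − 2(−1)^g` the residual of the REVERSED pair, whose budget is the
   same `B`.  Hence `|e_f| ≥ 25` at four points, and `B = Σ_y e_f(y)² ≥ #{v' odd} + 4·624 ≥ 2¹² + 2496 = 6592 > 6144`.  Contradiction.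

References: T. Kasami, N. Tokura, IEEE Trans. Inform. Theory 16 (1970); F. J. MacWilliams, N. J. A. Sloane (1977) Ch. 15;
R. O'Donnell (2014) §3.3.  Everything below is proved from Mathlib and the tree; standard axioms only.
-/

set_option linter.dupNamespace false -- D-0017: single-problem summit ⇒ `QuantumAdvantage.QuantumAdvantage` by design

noncomputable section

namespace Summit.QuantumAdvantage.QuantumAdvantage.Theorems.NearExactIsExact.Negative.LevelSixSixtyOneFourteen

open Finset
open Literature.Computability.QuantumComplexity
open Literature.Computability.QuantumComplexity.BuzetChailloux (bxor zeroVec bxor_bxor_cancel_left bxor_zeroVec zeroVec_bxor bxor_comm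
  signOf_sq)
open Literature.Computability.QuantumComplexity.DerivativeWalsh (W sum_W_sq twist_bxor_left sum_char_subspace)
open Summit.QuantumAdvantage.QuantumAdvantage.Theorems.CubicForrelation.NearExactIsExact
open Summit.QuantumAdvantage.QuantumAdvantage.Theorems.SignedCubicForrelationNotPrBPP.Negative.HalfQuad (forrelation_comm)
open Summit.QuantumAdvantage.QuantumAdvantage.Theorems.NearExactIsExact.Negative.LevelSixSixtyOnePrep

set_option maxHeartbeats 1600000 in
/-- **Level 6 × level 6 above `61/64` is impossible on 14 bits.**  For cubic `f, g : 𝔽₂¹⁴ → 𝔽₂` with `W_g = 64u'`, `W_f = 64v'`,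
some `u'(x)` odd and some `v'(y)` odd, `Φ(f,g) ≤ 61/64`.  (Slack version of `fl_levelSix_false`; see the module docstring.)
NOT summit progress. [this work] -/
theorem levelSix_pair_false_61 (f g : (Fin (7 + 7) → Bool) → Bool) (hf : IsDegLeFun 3 f) (hg : IsDegLeFun 3 g)
    (u' : (Fin (7 + 7) → Bool) → ℤ) (hu' : ∀ x, W (fun y => signOf (g y)) x = (2 : ℝ) ^ 6 * (u' x : ℝ))
    (v' : (Fin (7 + 7) → Bool) → ℤ) (hv' : ∀ y, W (fun x => signOf (f x)) y = (2 : ℝ) ^ 6 * (v' y : ℝ))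
    (hoddg : ∃ x, Odd (u' x)) (hoddf : ∃ y, Odd (v' y)) (hΦ : (61 / 64 : ℝ) < forrelation f g) : False := by
  classical
  -- (1) the parities are quadratic
  have hp : IsDegLeFun 2 (fun x => decide (Odd (u' x))) :=
    stub_walshTower stub_axParity (7 + 7) 6 2 g u' hg hu' (by intro k hk hkn; omega)
  have hq : IsDegLeFun 2 (fun y => decide (Odd (v' y))) :=
    stub_walshTower stub_axParity (7 + 7) 6 2 f v' hf hv' (by intro k hk hkn; omega)
  -- (2) the two budgets have the same value `B < 6144`
  set B : ℤ := ∑ x, (u' x - 2 * sZ (f x)) ^ 2 with hBdef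
  have hBR : ((B : ℤ) : ℝ) = (2 : ℝ) ^ 17 * (1 - forrelation f g) := by rw [hBdef]; exact fl_budget6 f g u' hu'
  have hBlt : B < 6144 := by
    have h : ((B : ℤ) : ℝ) < 6144 := by rw [hBR]; nlinarith
    exact_mod_cast h
  have hBf : (∑ y, (v' y - 2 * sZ (g y)) ^ 2 : ℤ) = B := by
    have h : ((∑ y, (v' y - 2 * sZ (g y)) ^ 2 : ℤ) : ℝ) = ((B : ℤ) : ℝ) := by
      rw [fl_budget6 g f v' hv', hBR, forrelation_comm]
    exact_mod_cast h
  -- (3) Reed–Muller: at least `2¹²` odd points on each side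
  obtain ⟨x₁, hx₁⟩ := hoddg
  obtain ⟨y₁, hy₁⟩ := hoddf
  have hfilt : (univ.filter fun x : Fin (7 + 7) → Bool => decide (Odd (u' x)) = true) = univ.filter fun x => Odd (u' x) :=
    filter_congr fun x _ => by rw [decide_eq_true_iff]
  have hfiltf : (univ.filter fun y : Fin (7 + 7) → Bool => decide (Odd (v' y)) = true) = univ.filter fun y => Odd (v' y) :=
    filter_congr fun y _ => by rw [decide_eq_true_iff]
  have hPge : 4096 ≤ #(univ.filter fun x : Fin (7 + 7) → Bool => Odd (u' x)) := by
    have h := bb_rmWeight_holds (7 + 7) 2 (fun x => decide (Odd (u' x))) hp ⟨x₁, decide_eq_true hx₁⟩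
    rw [hfilt] at h; norm_num at h; omega
  have hPfge : 4096 ≤ #(univ.filter fun y : Fin (7 + 7) → Bool => Odd (v' y)) := by
    have h := bb_rmWeight_holds (7 + 7) 2 (fun y => decide (Odd (v' y))) hq ⟨y₁, decide_eq_true hy₁⟩
    rw [hfiltf] at h; norm_num at h; omega
  -- (4) base cost: `≥ 1` per odd point
  have hsumP : (∑ x, (if Odd (u' x) then 1 else 0 : ℤ)) = #(univ.filter fun x : Fin (7 + 7) → Bool => Odd (u' x)) := by
    rw [sum_boole]
  have hsumPf : (∑ y, (if Odd (v' y) then 1 else 0 : ℤ)) = #(univ.filter fun y : Fin (7 + 7) → Bool => Odd (v' y)) := by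
    rw [sum_boole]
  have hodd_e : ∀ x, Odd (u' x) → Odd (u' x - 2 * sZ (f x)) := fun x h => Int.odd_sub.2 (iff_of_true h (even_two_mul _))
  have hodd_ef : ∀ y, Odd (v' y) → Odd (v' y - 2 * sZ (g y)) := fun y h => Int.odd_sub.2 (iff_of_true h (even_two_mul _))
  have hbase : ∀ x, (if Odd (u' x) then 1 else 0 : ℤ) ≤ (u' x - 2 * sZ (f x)) ^ 2 := by
    intro x
    by_cases h : Odd (u' x)
    · rw [if_pos h]; exact tp_res_sq_ge_one (tp_sZ_cases (f x)) h
    · rw [if_neg h]; exact sq_nonneg _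
  have hbasef : ∀ y, (if Odd (v' y) then 1 else 0 : ℤ) ≤ (v' y - 2 * sZ (g y)) ^ 2 := by
    intro y
    by_cases h : Odd (v' y)
    · rw [if_pos h]; exact tp_res_sq_ge_one (tp_sZ_cases (g y)) h
    · rw [if_neg h]; exact sq_nonneg _
  -- (5) `#P ≤ B < 6144`, so `#P = 2¹²` exactly (second weight of `RM(2,14)`)
  have hPle : (#(univ.filter fun x : Fin (7 + 7) → Bool => Odd (u' x)) : ℤ) ≤ B := by
    rw [← hsumP]; exact sum_le_sum fun x _ => hbase x
  have hPcard : #(univ.filter fun x : Fin (7 + 7) → Bool => decide (Odd (u' x)) = true) = 4096 := by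
    have hlt : #(univ.filter fun x : Fin (7 + 7) → Bool => Odd (u' x)) < 6144 := by
      have : (#(univ.filter fun x : Fin (7 + 7) → Bool => Odd (u' x)) : ℤ) < 6144 := hPle.trans_lt hBlt
      exact_mod_cast this
    have h := sw_quadratic_second_weight (fun x => decide (Odd (u' x))) hp ⟨x₁, decide_eq_true hx₁⟩
      (by rw [hfilt]; norm_num; omega)
    rw [hfilt] at h ⊢; norm_num at h; omega
  have hPcard' : #(univ.filter fun x : Fin (7 + 7) → Bool => Odd (u' x)) = 4096 := by rw [← hfilt]; exact hPcard
  -- (6) the odd set is a 12-flat `x₁ ⊕ V₀`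
  obtain ⟨h0, hadd, hcardV, hcoset⟩ := qf_flat_of_quadratic (fun x => decide (Odd (u' x))) hp hPcard
  set V₀ := univ.filter (fun a : Fin (7 + 7) → Bool => ∀ x, decide (Odd (u' (bxor x a))) = decide (Odd (u' x))) with hV₀
  have hPimg := hcoset x₁ (decide_eq_true hx₁)
  have hmemP : ∀ x, x ∈ (univ.filter fun x : Fin (7 + 7) → Bool => decide (Odd (u' x)) = true) ↔ Odd (u' x) := by
    intro x; simp
  have hin : ∀ z, Odd (u' z) → ∀ c ∈ V₀, Odd (u' (bxor z c)) := by
    intro z hz c hc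
    have h := (mem_filter.1 hc).2 z
    rw [decide_eq_decide] at h
    exact h.2 hz
  have hout : ∀ z, Odd (u' z) → ∀ t, t ∉ V₀ → ¬ Odd (u' (bxor z t)) := by
    intro z hz t ht hzt
    apply ht
    have key := fl_coset_translate V₀ _ x₁ hadd hPimg ((hmemP z).2 hz) h0 t
    rw [bxor_zeroVec] at key
    exact key.1 ((hmemP _).2 hzt)
  -- (7) the off-`P` defects `D` and their number
  set D := univ.filter (fun x : Fin (7 + 7) → Bool => ¬ Odd (u' x) ∧ u' x - 2 * sZ (f x) ≠ 0) with hDdef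
  have hz : ∀ q, ¬ Odd (u' q) → q ∉ D → 2 * u' q - 4 * sZ (f q) = 0 := by
    intro q hq hqD
    by_contra hne
    exact hqD (mem_filter.2 ⟨mem_univ _, hq, fun h => hne (by rw [show 2 * u' q - 4 * sZ (f q) = 2 * (u' q - 2 * sZ (f q)) by ring,
      h, mul_zero])⟩)
  have hDcard : #D ≤ 511 := by
    have h1 : ∀ x ∈ D, (4 : ℤ) ≤ (u' x - 2 * sZ (f x)) ^ 2 - (if Odd (u' x) then 1 else 0 : ℤ) := by
      intro x hx
      obtain ⟨hxo, hxe⟩ := (mem_filter.1 hx).2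
      rw [if_neg hxo, sub_zero]
      exact lsp_even_ne_zero_sq _ (fun h => hxo ((Int.odd_sub.1 h).2 (even_two_mul _))) hxe
    have h2 : ∑ x ∈ D, ((u' x - 2 * sZ (f x)) ^ 2 - (if Odd (u' x) then 1 else 0 : ℤ)) ≤
        ∑ x, ((u' x - 2 * sZ (f x)) ^ 2 - (if Odd (u' x) then 1 else 0 : ℤ)) :=
      sum_le_sum_of_subset_of_nonneg (subset_univ D) (fun x _ _ => by linarith [hbase x])
    have h3 : (4 : ℤ) * #D ≤ B - 4096 := by
      calc (4 : ℤ) * #D = ∑ x ∈ D, (4 : ℤ) := by rw [sum_const, nsmul_eq_mul]; ring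
        _ ≤ ∑ x ∈ D, ((u' x - 2 * sZ (f x)) ^ 2 - (if Odd (u' x) then 1 else 0 : ℤ)) := sum_le_sum h1
        _ ≤ ∑ x, ((u' x - 2 * sZ (f x)) ^ 2 - (if Odd (u' x) then 1 else 0 : ℤ)) := h2
        _ = B - #(univ.filter fun x : Fin (7 + 7) → Bool => Odd (u' x)) := by rw [sum_sub_distrib, hsumP]
        _ = B - 4096 := by rw [hPcard']; norm_num
    omega
  -- (8) the mod-4 sign is multiplicative on the coset through `x₁`
  have hmul : ∀ c ∈ V₀, ∀ c' ∈ V₀,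
      (2 - (u' (bxor x₁ (bxor c c')) - 2 * sZ (f (bxor x₁ (bxor c c')))) % 4) * (2 - (u' x₁ - 2 * sZ (f x₁)) % 4) =
        (2 - (u' (bxor x₁ c) - 2 * sZ (f (bxor x₁ c))) % 4) * (2 - (u' (bxor x₁ c') - 2 * sZ (f (bxor x₁ c'))) % 4) := by
    intro c hc c' hc'
    obtain ⟨d₁, d₂, hd₁, hd₂, hd₁₂, hgood⟩ :=
      lsp_dirs V₀ D (by rw [hcardV]) hDcard x₁ (bxor x₁ c') (bxor x₁ c) (bxor (bxor x₁ c') c)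
    have hd₂₁ : bxor d₂ d₁ ∉ V₀ := by rwa [bxor_comm] at hd₁₂
    have hg0 := hgood x₁ (by simp)
    have hg1 := hgood (bxor x₁ c') (by simp)
    have hg2 := hgood (bxor x₁ c) (by simp)
    have hg3 := hgood (bxor (bxor x₁ c') c) (by simp)
    have hu2 : ∀ x, W (fun y => signOf (g y)) x = (2 : ℝ) ^ 5 * ((2 * u' x : ℤ) : ℝ) := by
      intro x; rw [hu' x]; push_cast; ring
    have h8 := fs_flat_sum_dvd (e := 3) g (fun x => 2 * u' x) hg hu2 x₁
      (Fin.cons d₁ (Fin.cons d₂ (Fin.cons c (Fin.cons c' (fun i : Fin 0 => i.elim0) : Fin 1 → Fin (7 + 7) → Bool)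
        : Fin 2 → Fin (7 + 7) → Bool) : Fin 3 → Fin (7 + 7) → Bool) : Fin 4 → Fin (7 + 7) → Bool) (by norm_num)
    -- the sign part: `Σ_ε 4·s(f(pt ε)) ∈ 8ℤ` (sixteen odd terms)
    have hsZ : (8 : ℤ) ∣ ∑ ε : Fin 4 → Bool, 4 * sZ (f (fun j => x₁ j ^^ decide (Odd #(univ.filter fun i : Fin 4 => ε i &&
        (Fin.cons d₁ (Fin.cons d₂ (Fin.cons c (Fin.cons c' (fun i : Fin 0 => i.elim0) : Fin 1 → Fin (7 + 7) → Bool)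
          : Fin 2 → Fin (7 + 7) → Bool) : Fin 3 → Fin (7 + 7) → Bool) : Fin 4 → Fin (7 + 7) → Bool) i j)))) := by
      have e1 : ∀ b : Bool, 4 * sZ b = 4 - 8 * (if b then 1 else 0 : ℤ) := by intro b; cases b <;> simp [sZ]
      simp_rw [e1]
      rw [sum_sub_distrib, sum_const, card_univ, Fintype.card_fun, Fintype.card_bool, Fintype.card_fin, ← mul_sum]
      exact ⟨8 - ∑ ε : Fin 4 → Bool, (if f (fun j => x₁ j ^^ decide (Odd #(univ.filter fun i : Fin 4 => ε i &&
        (Fin.cons d₁ (Fin.cons d₂ (Fin.cons c (Fin.cons c' (fun i : Fin 0 => i.elim0) : Fin 1 → Fin (7 + 7) → Bool)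
          : Fin 2 → Fin (7 + 7) → Bool) : Fin 3 → Fin (7 + 7) → Bool) : Fin 4 → Fin (7 + 7) → Bool) i j))) then 1 else 0 : ℤ),
        by norm_num; ring⟩
    have hδ8 : (8 : ℤ) ∣ ∑ ε : Fin 4 → Bool, (2 * u' (fun j => x₁ j ^^ decide (Odd #(univ.filter fun i : Fin 4 => ε i &&
        (Fin.cons d₁ (Fin.cons d₂ (Fin.cons c (Fin.cons c' (fun i : Fin 0 => i.elim0) : Fin 1 → Fin (7 + 7) → Bool)
          : Fin 2 → Fin (7 + 7) → Bool) : Fin 3 → Fin (7 + 7) → Bool) : Fin 4 → Fin (7 + 7) → Bool) i j))) -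
        4 * sZ (f (fun j => x₁ j ^^ decide (Odd #(univ.filter fun i : Fin 4 => ε i &&
        (Fin.cons d₁ (Fin.cons d₂ (Fin.cons c (Fin.cons c' (fun i : Fin 0 => i.elim0) : Fin 1 → Fin (7 + 7) → Bool)
          : Fin 2 → Fin (7 + 7) → Bool) : Fin 3 → Fin (7 + 7) → Bool) : Fin 4 → Fin (7 + 7) → Bool) i j))))) := by
      rw [sum_sub_distrib]
      exact dvd_sub h8 hsZ
    simp only [tep_sum_split, Fintype.sum_unique, fl_pt_four, Bool.true_and, Bool.false_and, es_bxor_false,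
      show (fun j => c j) = c from rfl, show (fun j => c' j) = c' from rfl, show (fun j => d₁ j) = d₁ from rfl,
      show (fun j => d₂ j) = d₂ from rfl] at hδ8
    -- the four coset points are odd, the twelve translates are even and defect-free (so `u' = 2s` there)
    have o0 : Odd (u' x₁) := hx₁
    have o1 : Odd (u' (bxor x₁ c')) := hin _ hx₁ c' hc'
    have o2 : Odd (u' (bxor x₁ c)) := hin _ hx₁ c hc
    have o3 : Odd (u' (bxor (bxor x₁ c') c)) := hin _ o1 c hc
    have zA : ∀ p : Fin (7 + 7) → Bool, Odd (u' p) → bxor p d₂ ∉ D → 2 * u' (bxor p d₂) - 4 * sZ (f (bxor p d₂)) = 0 :=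
      fun p hp' hpD => hz _ (hout p hp' d₂ hd₂) hpD
    have zB : ∀ p : Fin (7 + 7) → Bool, Odd (u' p) → bxor p d₁ ∉ D → 2 * u' (bxor p d₁) - 4 * sZ (f (bxor p d₁)) = 0 :=
      fun p hp' hpD => hz _ (hout p hp' d₁ hd₁) hpD
    have zC : ∀ p : Fin (7 + 7) → Bool, Odd (u' p) → bxor (bxor p d₂) d₁ ∉ D →
        2 * u' (bxor (bxor p d₂) d₁) - 4 * sZ (f (bxor (bxor p d₂) d₁)) = 0 := by
      intro p hp' hpD
      have hno : ¬ Odd (u' (bxor (bxor p d₂) d₁)) := by rw [iw_bxor_assoc]; exact hout p hp' (bxor d₂ d₁) hd₂₁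
      exact hz _ hno hpD
    rw [zA _ o0 hg0.1, zA _ o1 hg1.1, zA _ o2 hg2.1, zA _ o3 hg3.1, zB _ o0 hg0.2.1, zB _ o1 hg1.2.1, zB _ o2 hg2.2.1,
      zB _ o3 hg3.2.1, zC _ o0 hg0.2.2, zC _ o1 hg1.2.2, zC _ o2 hg2.2.2, zC _ o3 hg3.2.2] at hδ8
    have h4 : (4 : ℤ) ∣ (u' x₁ - 2 * sZ (f x₁)) + (u' (bxor x₁ c') - 2 * sZ (f (bxor x₁ c'))) +
        (u' (bxor x₁ c) - 2 * sZ (f (bxor x₁ c))) + (u' (bxor (bxor x₁ c') c) - 2 * sZ (f (bxor (bxor x₁ c') c))) := by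
      omega
    have key := lsp_chi_mul (hodd_e _ o0) (hodd_e _ o1) (hodd_e _ o2) (hodd_e _ o3) h4
    rw [iw_bxor_assoc, bxor_comm c' c] at key
    rw [key, mul_comm]
  -- (9) the residual `A = e` and its mod-4 character `At = χ·1_P`
  let A : (Fin (7 + 7) → Bool) → ℝ := fun x => ((u' x - 2 * sZ (f x) : ℤ) : ℝ)
  let Ct : (Fin (7 + 7) → Bool) → ℤ := fun x => if Odd (u' x) then 2 - (u' x - 2 * sZ (f x)) % 4 else 0
  let At : (Fin (7 + 7) → Bool) → ℝ := fun x => ((Ct x : ℤ) : ℝ)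
  have hCt_on : ∀ x, Odd (u' x) → Ct x = 1 ∨ Ct x = -1 := by
    intro x hx
    rcases lsp_chi_cases _ (hodd_e x hx) with ⟨h, -⟩ | ⟨h, -⟩
    · left; simp only [Ct, if_pos hx, h]
    · right; simp only [Ct, if_pos hx, h]
  have hAton : ∀ c₀ ∈ V₀, At (bxor x₁ c₀) = 1 ∨ At (bxor x₁ c₀) = -1 := by
    intro c₀ hc₀
    rcases hCt_on _ (hin _ hx₁ c₀ hc₀) with h | h
    · left; simp only [At, h]; norm_num
    · right; simp only [At, h]; norm_num
  have hmulAt : ∀ c₀ ∈ V₀, ∀ c₀' ∈ V₀, At (bxor x₁ (bxor c₀ c₀')) * At x₁ = At (bxor x₁ c₀) * At (bxor x₁ c₀') := by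
    intro c₀ hc₀ c₀' hc₀'
    have o1 := hin _ hx₁ c₀ hc₀
    have o2 := hin _ hx₁ c₀' hc₀'
    have o3 := hin _ hx₁ (bxor c₀ c₀') (hadd _ hc₀ _ hc₀')
    simp only [At, Ct, if_pos hx₁, if_pos o1, if_pos o2, if_pos o3]
    exact_mod_cast hmul c₀ hc₀ c₀' hc₀'
  have hAtoff : ∀ x, ¬ Odd (u' x) → At x = 0 := by
    intro x hx; simp only [At, Ct, if_neg hx]; norm_num
  have hWAt : ∀ y, W At y = 0 ∨ W At y = 4096 ∨ W At y = -4096 := by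
    intro y
    have hsplit : W At y = ∑ c₀ ∈ V₀, At (bxor x₁ c₀) * twist (bxor x₁ c₀) y := by
      unfold W
      rw [← sum_filter_add_sum_filter_not univ (fun x : Fin (7 + 7) → Bool => decide (Odd (u' x)) = true)]
      have hzs : ∑ x ∈ univ.filter (fun x : Fin (7 + 7) → Bool => ¬ decide (Odd (u' x)) = true), At x * twist x y = 0 := by
        refine sum_eq_zero fun x hx => ?_
        have hx' : ¬ Odd (u' x) := by simpa using (mem_filter.1 hx).2
        rw [hAtoff x hx', zero_mul]
      rw [hzs, add_zero, hPimg, sum_image fun a _ b _ hab => by simpa only [bxor_bxor_cancel_left] using congrArg (bxor x₁) hab]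
    obtain ⟨r, hr, hsum⟩ := fl_char_coset V₀ h0 hadd x₁ At hAton hmulAt y
    rw [hsplit, hsum, hcardV]
    rcases hr with h | h | h <;> rw [h] <;> norm_num
  -- Parseval for `At`: `Σ_y Ât(y)² = 2¹⁴·2¹²`, hence exactly four frequencies
  have hPAt : ∑ y, W At y ^ 2 = (2 : ℝ) ^ (7 + 7) * 4096 := by
    rw [sum_W_sq]
    congr 1
    have hsq : ∀ x, At x ^ 2 = ((if Odd (u' x) then 1 else 0 : ℤ) : ℝ) := by
      intro x
      by_cases hx : Odd (u' x)
      · rw [if_pos hx]; rcases hCt_on x hx with h | h <;> simp only [At, h] <;> norm_num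
      · rw [if_neg hx, hAtoff x hx]; norm_num
    rw [sum_congr rfl fun x _ => hsq x, ← Int.cast_sum, hsumP, hPcard']
    norm_num
  set F := univ.filter (fun y : Fin (7 + 7) → Bool => W At y ≠ 0) with hFdef
  have hF4 : #F = 4 := lsp_four_freq (W At) hWAt hPAt
  -- (10) Walsh inversion: `Â = 256(−1)^g − 2 W_f = −128·e_f`
  have hinv : ∀ y, ∑ x, (u' x : ℝ) * twist x y = 256 * signOf (g y) := by
    intro y
    have h := tz_inversion (fun z => signOf (g z)) y
    rw [sum_congr rfl fun x _ => by rw [hu' x]] at h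
    have e : ∑ x, (2 : ℝ) ^ 6 * (u' x : ℝ) * twist x y = 2 ^ 6 * ∑ x, (u' x : ℝ) * twist x y := by
      rw [mul_sum]
      exact sum_congr rfl fun x _ => by ring
    rw [e] at h
    have h' : (2 : ℝ) ^ 6 * (∑ x, (u' x : ℝ) * twist x y - 256 * signOf (g y)) = 0 := by
      rw [mul_sub, h]; norm_num; ring
    have h2 : (2 : ℝ) ^ 6 ≠ 0 := by positivity
    linarith [(mul_eq_zero.1 h').resolve_left h2]
  have hFour : ∀ y, W A y = -128 * (((v' y - 2 * sZ (g y) : ℤ)) : ℝ) := by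
    intro y
    have hWA : W A y = 256 * signOf (g y) - 2 * W (fun x => signOf (f x)) y := by
      unfold W
      have e : ∀ x, A x * twist x y = (u' x : ℝ) * twist x y - 2 * (signOf (f x) * twist x y) := by
        intro x
        simp only [A]
        push_cast
        rw [tp_sZ_cast]
        ring
      rw [sum_congr rfl fun x _ => e x, sum_sub_distrib, ← mul_sum, hinv y]
    rw [hWA, hv' y]
    push_cast
    rw [tp_sZ_cast]
    ring
  -- (11) the residual is close to its character: `Σ_x |e − χ1_P| ≤ (B − 2¹²)/2`
  have herr : 2 * (∑ x, |(u' x - 2 * sZ (f x)) - Ct x|) ≤ B - 4096 := by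
    have hpt : ∀ x, 2 * |(u' x - 2 * sZ (f x)) - Ct x| ≤ (u' x - 2 * sZ (f x)) ^ 2 - (if Odd (u' x) then 1 else 0 : ℤ) := by
      intro x
      by_cases hx : Odd (u' x)
      · simp only [Ct, if_pos hx]
        exact lsp_cost_on _ (hodd_e x hx)
      · simp only [Ct, if_neg hx, sub_zero]
        exact lsp_cost_off _ (fun h => hx ((Int.odd_sub.1 h).2 (even_two_mul _)))
    have h := sum_le_sum fun x (_ : x ∈ (univ : Finset (Fin (7 + 7) → Bool))) => hpt x
    rw [← mul_sum, sum_sub_distrib, hsumP, hPcard'] at h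
    norm_num at h
    linarith
  have hdiff : ∀ y, |W A y - W At y| ≤ (((B - 4096 : ℤ)) : ℝ) / 2 := by
    intro y
    have h := lsp_W_diff_le (fun x => u' x - 2 * sZ (f x)) Ct y
    have h2 : ((∑ x, |(u' x - 2 * sZ (f x)) - Ct x| : ℤ) : ℝ) ≤ (((B - 4096 : ℤ)) : ℝ) / 2 := by
      have : (((2 * ∑ x, |(u' x - 2 * sZ (f x)) - Ct x| : ℤ)) : ℝ) ≤ (((B - 4096 : ℤ)) : ℝ) := by exact_mod_cast herr
      push_cast at this ⊢
      linarith
    exact h.trans h2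
  -- (12) at the four frequencies the reversed residual is large: `e_f(y)² ≥ 625`
  have hbig : ∀ y ∈ F, (625 : ℤ) ≤ (v' y - 2 * sZ (g y)) ^ 2 := by
    intro y hy
    have hne : W At y ≠ 0 := (mem_filter.1 hy).2
    have habs : |W At y| = 4096 := by
      rcases hWAt y with h | h | h
      · exact absurd h hne
      · rw [h]; norm_num
      · rw [h]; norm_num
    have h1 : (4096 : ℝ) ≤ |W A y| + (((B - 4096 : ℤ)) : ℝ) / 2 := by
      have := abs_sub_abs_le_abs_sub (W At y) (W A y)
      rw [abs_sub_comm] at this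
      linarith [hdiff y]
    have hB' : (((B - 4096 : ℤ)) : ℝ) < 2048 := by
      have : B - 4096 < 2048 := by omega
      exact_mod_cast this
    have h2 : (3072 : ℝ) < |W A y| := by linarith
    rw [hFour y, abs_mul, abs_neg, abs_of_pos (by norm_num : (0 : ℝ) < 128)] at h2
    have h3 : (24 : ℝ) < |(((v' y - 2 * sZ (g y) : ℤ)) : ℝ)| := by linarith
    have h4 : (24 : ℤ) < |v' y - 2 * sZ (g y)| := by
      rw [← Int.cast_abs] at h3
      exact_mod_cast h3
    have h5 : (25 : ℤ) ≤ |v' y - 2 * sZ (g y)| := by omega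
    nlinarith [sq_abs (v' y - 2 * sZ (g y)), abs_nonneg (v' y - 2 * sZ (g y))]
  -- (13) the reversed budget: `B ≥ 2¹² + 4·624 > 6144`
  have hlow : ∀ y, (if Odd (v' y) then 1 else 0 : ℤ) + (if y ∈ F then 624 else 0 : ℤ) ≤ (v' y - 2 * sZ (g y)) ^ 2 := by
    intro y
    by_cases hy : y ∈ F
    · rw [if_pos hy]
      have h := hbig y hy
      by_cases ho : Odd (v' y)
      · rw [if_pos ho]; linarith
      · rw [if_neg ho]; linarith
    · rw [if_neg hy, add_zero]; exact hbasef y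
  have hsumF : (∑ y, (if y ∈ F then 624 else 0 : ℤ)) = 2496 := by
    rw [sum_ite_mem, univ_inter, sum_const, nsmul_eq_mul, hF4]
    norm_num
  have htot := sum_le_sum fun y (_ : y ∈ (univ : Finset (Fin (7 + 7) → Bool))) => hlow y
  rw [sum_add_distrib, hsumPf, hsumF, hBf] at htot
  have : (4096 : ℤ) ≤ #(univ.filter fun y : Fin (7 + 7) → Bool => Odd (v' y)) := by exact_mod_cast hPfge
  linarith

/-- **Inequality form.**  Cubic `f, g` on `14` bits, both at level 6 proper (`W_g = 64u'`, `W_f = 64v'` with odd values):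
`Φ(f,g) ≤ 61/64`.  NOT summit progress. [this work] -/
theorem levelSix_pair_le_61 (f g : (Fin (7 + 7) → Bool) → Bool) (hf : IsDegLeFun 3 f) (hg : IsDegLeFun 3 g)
    (u' : (Fin (7 + 7) → Bool) → ℤ) (hu' : ∀ x, W (fun y => signOf (g y)) x = (2 : ℝ) ^ 6 * (u' x : ℝ))
    (v' : (Fin (7 + 7) → Bool) → ℤ) (hv' : ∀ y, W (fun x => signOf (f x)) y = (2 : ℝ) ^ 6 * (v' y : ℝ))
    (hoddg : ∃ x, Odd (u' x)) (hoddf : ∃ y, Odd (v' y)) : forrelation f g ≤ 61 / 64 :=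
  not_lt.mp fun h => levelSix_pair_false_61 f g hf hg u' hu' v' hv' hoddg hoddf h

end Summit.QuantumAdvantage.QuantumAdvantage.Theorems.NearExactIsExact.Negative.LevelSixSixtyOneFourteen

end
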